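import Summits.MatrixMultiplication.MatrixMultiplication.Theorems.FarEdgeDescentContactAtoms
import Mathlib.Analysis.Convex.Deriv
import Mathlib.Data.Fintype.Pigeonhole
import HarnessLib

/-!
# Route `FarEdgeDescent` — model worlds of the NEAR-VERTEX CUT `ω(ℂ) = 2 ⟺ NearTame ∧ NearSmooth`

Support module (def-free) for the asides `SmoothProfile` (stmt-MatrixMultiplication-27850) and `TameProfile`
(stmt-MatrixMultiplication-31917) of `Summits/MatrixMultiplication/MatrixMultiplication/Theses/FarEdgeDescent.lean`;
companion of `FarEdgeDescentNearVertex` / `FarEdgeDescentNearEdgeCut` (gen 23).  Two EXPLICIT model profiles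
`F : ℝ → ℝ` of the near edge `x ∈ [0,1]` of `f(x) = ω(1,x,1)` (statements about these functions, not about `ω`;
«`P`-shape» = the statement `P` of the near-vertex cut with `ω(1,·,1)` replaced by `F` and the dual exponent
`α` replaced by the world's floor endpoint `1/2`), witnessing that EACH leaf of the near-vertex cut is
load-bearing and that neither leaf alone is the summit in worlds:

* `nearPolygonWorld`  `F(x) = 2 + (x − 1/2)₊/2` — convex, `F ≡ 2` exactly on `(-∞, 1/2]`, `F(1) = 9/4 > 2`
  (`ω > 2`-shape): `NearTame`-shape (two affine pieces `2` and `x/2 + 7/4` on `[0,1]`) ∧ CORNER departure of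
  slope `1/2` at `1/2` ∧ NOT differentiable at `1/2`, hence ¬`NearSmooth`-shape.  The generic leaf is
  load-bearing; this is the world it kills.
* `nearParabolaWorld`  `F(x) = 2 + (x − 1/2)₊²` — convex, `F ≡ 2` exactly on `(-∞, 1/2]`, `F(1) = 9/4 > 2`:
  `NearSmooth`-shape (differentiable EVERYWHERE, at `1/2` by `hasDerivAt_iff_isLittleO`) ∧ TANGENTIAL departure
  (no positive-slope support line at `1/2`) ∧ ¬`NearTame`-shape (a finite maximum of affine functions agreeing
  with `F` on `[0,1]` would have one piece active at two of any `N+2` points of `(1/2,1]` — pigeonhole — and then,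
  `F` lying above that piece, at their midpoint, contradicting strict convexity of the square).  The special leaf
  is load-bearing; this is the world it kills.

Both worlds obey the profile laws the leaves are compared under (convex on `ℝ`, constant `2` up to a positive
floor endpoint, `> 2` beyond it, slope `≤ 1` on `[0,1]`).  Nothing here is a statement about `ω`; no items change.
Written by the decomp-mm lens-2 planner seat (gen 23); imports only BUILT modules, restates nothing.
-/

set_option linter.dupNamespace false

noncomputable section

namespace Summit.MatrixMultiplication.MatrixMultiplication.Theorems.FarEdgeDescentNearWorlds

open Filter Topology Set Asymptotics

/-- **Near polygon world** `F(x) = 2 + (x − 1/2)₊/2`: `NearTame`-shape (two affine pieces on `[0,1]`),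
a CORNER of slope `1/2` at the floor endpoint `1/2`, NOT differentiable there (so ¬`NearSmooth`-shape),
`ω > 2`-shape (`F 1 > 2`), convex on `ℝ`, `F ≡ 2` exactly on `(-∞, 1/2]`. -/
theorem nearPolygonWorld :
    (∃ N : ℕ, ∃ c d : Fin (N + 1) → ℝ, ∀ m : ℝ, 0 ≤ m → m ≤ 1 →
      IsGreatest (Set.range fun i : Fin (N + 1) => c i * m + d i)
        ((fun x : ℝ => 2 + max (x - 1 / 2) 0 / 2) m)) ∧
    (∃ s : ℝ, 0 < s ∧ ∀ x : ℝ, 2 + s * (x - 1 / 2) ≤ (fun x : ℝ => 2 + max (x - 1 / 2) 0 / 2) x) ∧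
    ¬ DifferentiableAt ℝ (fun x : ℝ => 2 + max (x - 1 / 2) 0 / 2) (1 / 2) ∧
    ¬ (∀ x : ℝ, 0 ≤ x → x < 1 → DifferentiableAt ℝ (fun x : ℝ => 2 + max (x - 1 / 2) 0 / 2) x) ∧
    (2 < (fun x : ℝ => 2 + max (x - 1 / 2) 0 / 2) 1) ∧
    ConvexOn ℝ univ (fun x : ℝ => 2 + max (x - 1 / 2) 0 / 2) ∧
    (∀ x : ℝ, x ≤ 1 / 2 → (fun x : ℝ => 2 + max (x - 1 / 2) 0 / 2) x = 2) ∧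
    (∀ x : ℝ, 1 / 2 < x → 2 < (fun x : ℝ => 2 + max (x - 1 / 2) 0 / 2) x) := by
  have hnd : ¬ DifferentiableAt ℝ (fun x : ℝ => 2 + max (x - 1 / 2) 0 / 2) (1 / 2) := by
    intro hd
    have hl : HasDerivWithinAt (fun x : ℝ => 2 + max (x - 1 / 2) 0 / 2) 0 (Iio (1 / 2)) (1 / 2) := by
      refine (hasDerivWithinAt_const (1 / 2 : ℝ) (Iio (1 / 2)) (2 : ℝ)).congr_of_eventuallyEq ?_ ?_
      · filter_upwards [self_mem_nhdsWithin] with y hy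
        rw [max_eq_right (by linarith [mem_Iio.1 hy])]
        norm_num
      · norm_num
    have hr : HasDerivWithinAt (fun x : ℝ => 2 + max (x - 1 / 2) 0 / 2) (1 / 2) (Ioi (1 / 2)) (1 / 2) := by
      have h1 : HasDerivAt (fun x : ℝ => 2 + (x - 1 / 2) / 2) (1 / 2) (1 / 2) :=
        (((hasDerivAt_id' (1 / 2 : ℝ)).sub_const (1 / 2)).div_const 2).const_add 2
      refine h1.hasDerivWithinAt.congr_of_eventuallyEq ?_ ?_
      · filter_upwards [self_mem_nhdsWithin] with y hy
        rw [max_eq_left (by linarith [mem_Ioi.1 hy])]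
      · norm_num
    have e0 : deriv (fun x : ℝ => 2 + max (x - 1 / 2) 0 / 2) (1 / 2) = 0 :=
      UniqueDiffWithinAt.eq_deriv _ (uniqueDiffWithinAt_Iio _) hd.hasDerivAt.hasDerivWithinAt hl
    have e1 : deriv (fun x : ℝ => 2 + max (x - 1 / 2) 0 / 2) (1 / 2) = 1 / 2 :=
      UniqueDiffWithinAt.eq_deriv _ (uniqueDiffWithinAt_Ioi _) hd.hasDerivAt.hasDerivWithinAt hr
    linarith
  refine ⟨?_, ⟨1 / 2, by norm_num, fun x => ?_⟩, hnd, fun h => hnd (h _ (by norm_num) (by norm_num)),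
    by norm_num, ?_, fun x hx => ?_, fun x hx => ?_⟩
  · -- two affine pieces, indexed by `i ∈ {0,1}`: `(i/2)·m + (2 − i/4)`, i.e. `2` and `m/2 + 7/4`
    refine ⟨1, fun i => ((i : ℕ) : ℝ) / 2, fun i => 2 - ((i : ℕ) : ℝ) / 4, fun m hm0 hm1 => ⟨?_, ?_⟩⟩
    · rcases le_or_gt m (1 / 2) with hm | hm
      · refine ⟨⟨0, by omega⟩, ?_⟩
        simp only [Nat.cast_zero]
        rw [max_eq_right (by linarith)]
        ring
      · refine ⟨⟨1, by omega⟩, ?_⟩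
        simp only [Nat.cast_one]
        rw [max_eq_left (by linarith)]
        ring
    · rintro _ ⟨i, rfl⟩
      have hi0 : (0 : ℝ) ≤ ((i : ℕ) : ℝ) := Nat.cast_nonneg _
      have hi1 : ((i : ℕ) : ℝ) ≤ 1 := by
        have := i.isLt
        exact_mod_cast (by omega : (i : ℕ) ≤ 1)
      simp only
      rcases le_or_gt m (1 / 2) with hm | hm
      · rw [max_eq_right (by linarith)]
        nlinarith [mul_nonneg hi0 (by linarith : (0 : ℝ) ≤ 1 / 2 - m)]
      · rw [max_eq_left (by linarith)]
        nlinarith [mul_nonneg (by linarith : (0 : ℝ) ≤ 1 - ((i : ℕ) : ℝ)) (by linarith : (0 : ℝ) ≤ m - 1 / 2)]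
  · simp only
    nlinarith [le_max_left (x - 1 / 2) 0]
  · refine ⟨convex_univ, fun x _ y _ a b ha hb hab => ?_⟩
    simp only [smul_eq_mul]
    have h1 : max (a * x + b * y - 1 / 2) 0 ≤ a * max (x - 1 / 2) 0 + b * max (y - 1 / 2) 0 := by
      refine max_le ?_ ?_
      · nlinarith [mul_le_mul_of_nonneg_left (le_max_left (x - 1 / 2) 0) ha,
          mul_le_mul_of_nonneg_left (le_max_left (y - 1 / 2) 0) hb]
      · nlinarith [mul_nonneg ha (le_max_right (x - 1 / 2) 0), mul_nonneg hb (le_max_right (y - 1 / 2) 0)]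
    nlinarith [h1]
  · simp only
    rw [max_eq_right (by linarith)]
    norm_num
  · simp only
    rw [max_eq_left (by linarith)]
    linarith

/-- **Near parabola world** `F(x) = 2 + (x − 1/2)₊²`: `NearSmooth`-shape (differentiable everywhere),
TANGENTIAL departure at the floor endpoint `1/2` (no support line of positive slope there), NOT
`NearTame`-shape (pigeonhole + strict convexity), `ω > 2`-shape, convex on `ℝ`, `F ≡ 2` exactly on
`(-∞, 1/2]`. -/
theorem nearParabolaWorld :
    (∀ x : ℝ, DifferentiableAt ℝ (fun x : ℝ => 2 + max (x - 1 / 2) 0 ^ 2) x) ∧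
    (∀ x : ℝ, 0 ≤ x → x < 1 → DifferentiableAt ℝ (fun x : ℝ => 2 + max (x - 1 / 2) 0 ^ 2) x) ∧
    ¬ (∃ s : ℝ, 0 < s ∧ ∀ x : ℝ, 2 + s * (x - 1 / 2) ≤ (fun x : ℝ => 2 + max (x - 1 / 2) 0 ^ 2) x) ∧
    ¬ (∃ N : ℕ, ∃ c d : Fin (N + 1) → ℝ, ∀ m : ℝ, 0 ≤ m → m ≤ 1 →
      IsGreatest (Set.range fun i : Fin (N + 1) => c i * m + d i)
        ((fun x : ℝ => 2 + max (x - 1 / 2) 0 ^ 2) m)) ∧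
    (2 < (fun x : ℝ => 2 + max (x - 1 / 2) 0 ^ 2) 1) ∧
    ConvexOn ℝ univ (fun x : ℝ => 2 + max (x - 1 / 2) 0 ^ 2) ∧
    (∀ x : ℝ, x ≤ 1 / 2 → (fun x : ℝ => 2 + max (x - 1 / 2) 0 ^ 2) x = 2) ∧
    (∀ x : ℝ, 1 / 2 < x → 2 < (fun x : ℝ => 2 + max (x - 1 / 2) 0 ^ 2) x) := by
  have hdiff : ∀ x : ℝ, DifferentiableAt ℝ (fun x : ℝ => 2 + max (x - 1 / 2) 0 ^ 2) x := by
    intro x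
    refine DifferentiableAt.add (differentiableAt_const _) ?_
    rcases lt_trichotomy x (1 / 2) with hx | hx | hx
    · have hev : (fun y : ℝ => max (y - 1 / 2) 0 ^ 2) =ᶠ[𝓝 x] fun _ => (0 : ℝ) := by
        filter_upwards [Iio_mem_nhds hx] with y hy
        rw [max_eq_right (by linarith [mem_Iio.1 hy])]
        norm_num
      exact (differentiableAt_const (0 : ℝ)).congr_of_eventuallyEq hev
    · subst hx
      have hlo : (fun y : ℝ => max (y - 1 / 2) 0 ^ 2 - max ((1 / 2 : ℝ) - 1 / 2) 0 ^ 2 - (y - 1 / 2) • (0 : ℝ))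
          =o[𝓝 (1 / 2 : ℝ)] fun y => y - 1 / 2 := by
        refine IsBigO.trans_isLittleO (g := fun y : ℝ => ‖y - 1 / 2‖ ^ 2) ?_
          (isLittleO_pow_sub_sub (1 / 2 : ℝ) one_lt_two)
        refine IsBigO.of_bound 1 ?_
        filter_upwards with y
        have h0 : 0 ≤ max (y - 1 / 2) 0 := le_max_right _ _
        have h1 : max (y - 1 / 2) 0 ≤ |y - 1 / 2| := max_le (le_abs_self _) (abs_nonneg _)
        have h2 : max (y - 1 / 2) 0 ^ 2 ≤ |y - 1 / 2| ^ 2 := pow_le_pow_left₀ h0 h1 2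
        simp only [sub_self, max_self, ne_eq, OfNat.ofNat_ne_zero, not_false_eq_true, zero_pow, sub_zero,
          smul_zero, one_mul, norm_pow, Real.norm_eq_abs, abs_abs]
        rw [abs_of_nonneg h0]
        exact h2
      exact (hasDerivAt_iff_isLittleO.2 hlo).differentiableAt
    · have hev : (fun y : ℝ => max (y - 1 / 2) 0 ^ 2) =ᶠ[𝓝 x] fun y : ℝ => (y - 1 / 2) ^ 2 := by
        filter_upwards [Ioi_mem_nhds hx] with y hy
        rw [max_eq_left (by linarith [mem_Ioi.1 hy])]
      exact (show DifferentiableAt ℝ (fun y : ℝ => (y - 1 / 2) ^ 2) x by fun_prop).congr_of_eventuallyEq hev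
  refine ⟨hdiff, fun x _ _ => hdiff x, ?_, ?_, by norm_num, ?_, fun x hx => ?_, fun x hx => ?_⟩
  · -- no corner: a support line of slope `s > 0` fails at `x = 1/2 + s/2`
    rintro ⟨s, hs, h⟩
    have h1 := h (1 / 2 + s / 2)
    simp only at h1
    rw [max_eq_left (by linarith)] at h1
    nlinarith
  · -- not a finite maximum of affine functions on `[0,1]`
    rintro ⟨N, c, d, h⟩
    -- `N + 2` distinct sample points in `(1/2, 1]`
    obtain ⟨p, hp_gt, hp_le, hp_inj⟩ : ∃ p : Fin (N + 2) → ℝ,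
        (∀ j, 1 / 2 < p j) ∧ (∀ j, p j ≤ 1) ∧ Function.Injective p := by
      have hD : (0 : ℝ) < 2 * ((N : ℝ) + 2) := by positivity
      refine ⟨fun j => 1 / 2 + (((j : ℕ) : ℝ) + 1) / (2 * ((N : ℝ) + 2)), fun j => ?_, fun j => ?_, ?_⟩
      · have : (0 : ℝ) < (((j : ℕ) : ℝ) + 1) / (2 * ((N : ℝ) + 2)) := by positivity
        simp only
        linarith
      · have hj : ((j : ℕ) : ℝ) + 1 ≤ (N : ℝ) + 2 := by
          have := j.isLt
          exact_mod_cast (by omega : (j : ℕ) + 1 ≤ N + 2)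
        have : (((j : ℕ) : ℝ) + 1) / (2 * ((N : ℝ) + 2)) ≤ 1 / 2 := by
          rw [div_le_iff₀ hD]
          linarith
        simp only
        linarith
      · intro j k hjk
        simp only [add_right_inj] at hjk
        rw [div_left_inj' hD.ne', add_left_inj] at hjk
        exact Fin.ext (by exact_mod_cast hjk)
    -- the active piece at each sample point; two sample points share a piece (pigeonhole)
    choose g hg using fun j => (h (p j) (by linarith [hp_gt j]) (hp_le j)).1
    obtain ⟨j, k, hjk, hg_eq⟩ := Fintype.exists_ne_map_eq_of_card_lt g (by simp only [Fintype.card_fin]; omega)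
    have hne : p j - p k ≠ 0 := fun e => hjk (hp_inj (sub_eq_zero.1 e))
    have hj' := hg j
    have hk' := hg k
    rw [← hg_eq] at hk'
    -- `F` lies above that piece at the midpoint
    have hmid := (h ((p j + p k) / 2) (by linarith [hp_gt j, hp_gt k])
      (by linarith [hp_le j, hp_le k])).2 ⟨g j, rfl⟩
    simp only at hj' hk' hmid
    rw [max_eq_left (by linarith [hp_gt j])] at hj'
    rw [max_eq_left (by linarith [hp_gt k])] at hk'
    rw [max_eq_left (by linarith [hp_gt j, hp_gt k])] at hmid
    -- strict convexity of the square: contradiction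
    have hsq : 0 < (p j - p k) ^ 2 := by positivity
    nlinarith [hj', hk', hmid, hsq]
  · refine ⟨convex_univ, fun x _ y _ a b ha hb hab => ?_⟩
    simp only [smul_eq_mul]
    have h1 : max (a * x + b * y - 1 / 2) 0 ≤ a * max (x - 1 / 2) 0 + b * max (y - 1 / 2) 0 := by
      refine max_le ?_ ?_
      · nlinarith [mul_le_mul_of_nonneg_left (le_max_left (x - 1 / 2) 0) ha,
          mul_le_mul_of_nonneg_left (le_max_left (y - 1 / 2) 0) hb]
      · nlinarith [mul_nonneg ha (le_max_right (x - 1 / 2) 0), mul_nonneg hb (le_max_right (y - 1 / 2) 0)]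
    have h0 : 0 ≤ max (a * x + b * y - 1 / 2) 0 := le_max_right _ _
    have h2 : max (a * x + b * y - 1 / 2) 0 ^ 2 ≤ (a * max (x - 1 / 2) 0 + b * max (y - 1 / 2) 0) ^ 2 :=
      pow_le_pow_left₀ h0 h1 2
    have h3 : (a * max (x - 1 / 2) 0 + b * max (y - 1 / 2) 0) ^ 2 ≤
        a * max (x - 1 / 2) 0 ^ 2 + b * max (y - 1 / 2) 0 ^ 2 := by
      have hb' : b = 1 - a := by linarith
      subst hb'
      nlinarith [mul_nonneg ha hb, sq_nonneg (max (x - 1 / 2) 0 - max (y - 1 / 2) 0)]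
    nlinarith [h2, h3]
  · simp only
    rw [max_eq_right (by linarith)]
    norm_num
  · simp only
    rw [max_eq_left (by linarith)]
    nlinarith

/-- The two near leaves are INDEPENDENT in worlds and each is load-bearing: the polygon world has the special
leaf's shape without the generic leaf's, the parabola world the generic leaf's shape without the special leaf's;
both are `ω > 2`-shaped.  (So neither `NearTame`-shape nor `NearSmooth`-shape alone forces the `ω = 2`-shape.) -/
theorem near_leaves_independent :
    ((∃ N : ℕ, ∃ c d : Fin (N + 1) → ℝ, ∀ m : ℝ, 0 ≤ m → m ≤ 1 →
        IsGreatest (Set.range fun i : Fin (N + 1) => c i * m + d i)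
          ((fun x : ℝ => 2 + max (x - 1 / 2) 0 / 2) m)) ∧
      ¬ (∀ x : ℝ, 0 ≤ x → x < 1 → DifferentiableAt ℝ (fun x : ℝ => 2 + max (x - 1 / 2) 0 / 2) x) ∧
      2 < (fun x : ℝ => 2 + max (x - 1 / 2) 0 / 2) 1) ∧
    ((∀ x : ℝ, 0 ≤ x → x < 1 → DifferentiableAt ℝ (fun x : ℝ => 2 + max (x - 1 / 2) 0 ^ 2) x) ∧
      ¬ (∃ N : ℕ, ∃ c d : Fin (N + 1) → ℝ, ∀ m : ℝ, 0 ≤ m → m ≤ 1 →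
        IsGreatest (Set.range fun i : Fin (N + 1) => c i * m + d i)
          ((fun x : ℝ => 2 + max (x - 1 / 2) 0 ^ 2) m)) ∧
      2 < (fun x : ℝ => 2 + max (x - 1 / 2) 0 ^ 2) 1) :=
  ⟨⟨nearPolygonWorld.1, nearPolygonWorld.2.2.2.1, nearPolygonWorld.2.2.2.2.1⟩,
    ⟨nearParabolaWorld.2.1, nearParabolaWorld.2.2.2.1, nearParabolaWorld.2.2.2.2.1⟩⟩

end Summit.MatrixMultiplication.MatrixMultiplication.Theorems.FarEdgeDescentNearWorlds

end
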